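import Literature.AlgebraicGeometry.ShimuraVarieties.UnitaryAuxiliarySymplecticAdelic
import Literature.AlgebraicGeometry.ShimuraVarieties.UnitaryAuxiliaryComplexStructureInjective
import HarnessLib

/-!
# Rational points of the auxiliary symplectic embedding: injectivity of `ũ_β` on finite adèles and rational descent

Informal companion: [[UnitaryAuxiliarySymplecticRationalPoints.md]] (this file is the Lean half).

For the group-map carrier `ũ_β : U(H) × T₀(M) → GSp_δ` of Deligne's Prop. 2.3.10 / Milne §8 read in a symplectic
frame `β` (★ `auxToGspFin`, ★ `auxToGspRat`) we prove the two inputs of Deligne 1971 Prop. 1.15 («`Sh(G₁) → Sh(G₂)` est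
un plongement fermé si `G₁ → G₂` est injectif») consumed by the T3 injectivity prover: §1 `auxToGspFin_injective`
(★ `auxRep_injective` of `UnitaryAuxiliaryComplexStructureInjective` and injectivity of the transports — `1 ⊗ j` by flatness of `𝔸_{ℚ,f}` over `ℚ`);
§2 descent lemmas along `ℚ → R` in the coordinates `1 ⊗ b_k` (rational coordinates ⇒ `1 ⊗ m`; `1 ⊗ y = r ⊗ 1 ⇒ y ∈ ℚ`;
`(1 ⊗ j) z = 1 ⊗ x ⇒ z = 1 ⊗ l` by a `ℚ`-linear retraction of `j`); §3
`exists_auxToGspRat_eq_of_gspRationalToFinAdelic_eq`: `ũ_β(G₁(𝔸_f)) ∩ GSp_δ(ℚ) = ũ_β(G₁(ℚ))` (hypothesis 1.15.3).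
-/

open Matrix NumberField IsDedekindDomain
open scoped TensorProduct

namespace Literature.AlgebraicGeometry.ShimuraVarieties

namespace UnitaryCanonicalModel

namespace Aux

open Literature.AlgebraicGeometry.ModuliOfAbelianVarieties
open Literature.NumberTheory.ComplexMultiplication (ratFiniteAdeleTensorEquiv ratFiniteAdeleTensorEquiv_tmul
  ratFiniteAdeleTensorEquiv_symm_algebraMap ratFiniteAdeleTensorEquiv_one_tmul)
open Literature.NumberTheory.Automorphic Literature.NumberTheory.Automorphic.UnitaryGroup
open Literature.NumberTheory.AdelicBaseChange (finiteAdeleRing_mapSemialgHom_apply_eq_baseChange)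

/-! ### §1. Injectivity of the transports and of `ũ_β` on finite adèles -/

section Injective

variable {L : Type} [Field L] [NumberField L] [IsCMField L] (M : Type) [Field M] [NumberField M] [IsCMField M]
  (j : L →+* M) (H : Matrix (Fin 3) (Fin 3) L)

/-- The transport `T₀(M)(𝔸_f) → (𝔸_{ℚ,f} ⊗ M)ˣ` is injective. [cite: Deligne1979ShimuraVarieties, Prop. 2.3.10 (PDF p. 32)] -/
theorem torusToTensorFin_injective : Function.Injective (torusToTensorFin M) := by
  intro t t' h
  refine Subtype.ext (Units.ext ((ratFiniteAdeleTensorEquiv M).symm.injective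
    (congrArg (fun u : (finAdeleQ ⊗[ℚ] M)ˣ => (u : finAdeleQ ⊗[ℚ] M)) h)))

omit [IsCMField L] [IsCMField M] in
/-- `𝔸_{L,f} → 𝔸_{ℚ,f} ⊗_ℚ M` is injective (`1 ⊗ j` is injective by flatness of `𝔸_{ℚ,f}` over the field `ℚ`).
[cite: CasselsFrohlichANT1967, Ch. II §14 (14.2)] -/
theorem finAdeleToTensor_injective : Function.Injective (finAdeleToTensor M j) := by
  have h1 : Function.Injective (Algebra.TensorProduct.map (AlgHom.id finAdeleQ finAdeleQ) j.toRatAlgHom) := by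
    have h := Module.Flat.lTensor_preserves_injective_linearMap (M := finAdeleQ) j.toRatAlgHom.toLinearMap
      j.injective
    intro x y hxy
    exact h hxy
  exact h1.comp (ratFiniteAdeleTensorEquiv L).symm.injective

omit [IsCMField M] in
/-- The transport `U(H)(𝔸_f) → GL₃(𝔸_{ℚ,f} ⊗ M)` is injective. [cite: Deligne1979ShimuraVarieties, Prop. 2.3.10 (PDF p. 32)] -/
theorem unitaryToTensorFin_injective : Function.Injective (unitaryToTensorFin M j H) := by
  intro a a' h
  refine Subtype.ext (Units.ext (Matrix.map_injective (finAdeleToTensor_injective M j)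
    (congrArg (fun g : GL (Fin 3) (finAdeleQ ⊗[ℚ] M) => (g : Matrix (Fin 3) (Fin 3) (finAdeleQ ⊗[ℚ] M))) h)))

variable {M j H} {ξ₀ ξ : M} {g : ℕ} {δ : Fin g → ℕ}

/-- **`ũ_β` is injective on finite-adelic points** (`U(H)(𝔸_f) × T₀(M)(𝔸_f) ↪ GSp_δ(𝔸_{ℚ,f})`): the group map of
Deligne's Prop. 2.3.10 is a closed immersion, in particular injective on points. [cite: Deligne1979ShimuraVarieties, Prop. 2.3.10 (PDF p. 32)]
[cite: Deligne1971TravauxShimura, Prop. 1.15 p. 132] -/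
theorem auxToGspFin_injective (F : SymplecticFrame M j H ξ₀ ξ g δ) : Function.Injective (auxToGspFin F) := by
  rintro ⟨a, t⟩ ⟨a', t'⟩ h
  have h' := congrArg Subtype.val h
  rw [coe_auxToGspFin, coe_auxToGspFin] at h'
  obtain ⟨ht, ha⟩ := Prod.mk.inj (auxRep_injective _ F h')
  exact Prod.ext (unitaryToTensorFin_injective M j H ha) (torusToTensorFin_injective M ht)

end Injective

/-! ### §2. Descent along `ℚ → R` in the coordinates `1 ⊗ b_k` -/

section Descent

variable {R : Type} [CommRing R] [Algebra ℚ R] {M : Type} [Field M] [NumberField M]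

/-- An element of `R ⊗_ℚ M` all of whose coordinates in the basis `1 ⊗ b_k` are rational is `1 ⊗ m`. [cite: Deligne1971TravauxShimura, 4.9 p. 148] -/
theorem exists_eq_one_tmul_of_repr_mem_range (z : R ⊗[ℚ] M)
    (hz : ∀ k, (Algebra.TensorProduct.basis R (ratBasis M)).repr z k ∈ Set.range (algebraMap ℚ R)) :
    ∃ m : M, z = (1 : R) ⊗ₜ[ℚ] m := by
  choose q hq using hz
  refine ⟨∑ k, q k • ratBasis M k, ?_⟩
  rw [TensorProduct.tmul_sum]
  conv_lhs => rw [← (Algebra.TensorProduct.basis R (ratBasis M)).sum_repr z]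
  refine Finset.sum_congr rfl fun k _ => ?_
  rw [← hq k, Algebra.TensorProduct.basis_apply, TensorProduct.tmul_smul, TensorProduct.smul_tmul',
    TensorProduct.smul_tmul', Algebra.algebraMap_eq_smul_one, smul_assoc, one_smul]

/-- `1 = Σ_l c_l · (1 ⊗ b_l)` with `c = ` the coordinates of `1 ∈ M`. [folklore] -/
private theorem one_eq_sum_repr_one_smul_basis :
    (1 : R ⊗[ℚ] M) = ∑ l, algebraMap ℚ R ((ratBasis M).repr 1 l) • Algebra.TensorProduct.basis R (ratBasis M) l := by
  have h1 : (1 : R ⊗[ℚ] M) = (1 : R) ⊗ₜ[ℚ] (∑ l, (ratBasis M).repr 1 l • ratBasis M l) := by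
    rw [(ratBasis M).sum_repr 1]; rfl
  rw [h1, TensorProduct.tmul_sum]
  refine Finset.sum_congr rfl fun l _ => ?_
  rw [Algebra.TensorProduct.basis_apply, TensorProduct.tmul_smul, TensorProduct.smul_tmul', TensorProduct.smul_tmul',
    Algebra.algebraMap_eq_smul_one, smul_assoc, one_smul]

/-- **Matrix descent**: a matrix over `R ⊗_ℚ M` whose restriction of scalars along `1 ⊗ b` is a RATIONAL matrix
comes from a matrix over `M` (`A = 1 ⊗ A₀`). [cite: Deligne1971TravauxShimura, 4.9 p. 148] -/
theorem exists_eq_map_one_tmul_of_resMatrix_eq_map {m : Type} [Fintype m] [DecidableEq m]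
    (A : Matrix m m (R ⊗[ℚ] M)) (N₀ : Matrix (m × Fin (Module.finrank ℚ M)) (m × Fin (Module.finrank ℚ M)) ℚ)
    (h : resMatrix (Algebra.TensorProduct.basis R (ratBasis M)) A = N₀.map (algebraMap ℚ R)) :
    ∃ A₀ : Matrix m m M, A = A₀.map fun x : M => (1 : R) ⊗ₜ[ℚ] x := by
  have hcoord : ∀ i i' k, (Algebra.TensorProduct.basis R (ratBasis M)).repr (A i i') k ∈ Set.range (algebraMap ℚ R) := by
    intro i i' k
    have hk : (Algebra.TensorProduct.basis R (ratBasis M)).repr (A i i') k =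
        ∑ l, algebraMap ℚ R ((ratBasis M).repr 1 l) *
          resMatrix (Algebra.TensorProduct.basis R (ratBasis M)) A (i, k) (i', l) := by
      conv_lhs => rw [← mul_one (A i i'), one_eq_sum_repr_one_smul_basis (R := R) (M := M), Finset.mul_sum, map_sum,
        Finset.sum_apply']
      refine Finset.sum_congr rfl fun l _ => ?_
      rw [mul_smul_comm, map_smul, Finsupp.smul_apply, smul_eq_mul, resMatrix_apply]
    refine ⟨∑ l, (ratBasis M).repr 1 l * N₀ (i, k) (i', l), ?_⟩
    rw [hk, map_sum]
    refine Finset.sum_congr rfl fun l _ => ?_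
    rw [map_mul, h, Matrix.map_apply]
  choose A₀ hA₀ using fun i i' => exists_eq_one_tmul_of_repr_mem_range (A i i') (hcoord i i')
  exact ⟨Matrix.of A₀, by ext i i'; rw [Matrix.map_apply, Matrix.of_apply]; exact hA₀ i i'⟩

/-- **Scalar descent `(R ⊗ ℚ·1) ∩ (1 ⊗ M) = ℚ`**: if `1 ⊗ y = r ⊗ 1` in `R ⊗_ℚ M` (with `ℚ → R` injective), then
`y = q ∈ ℚ` and `r = q` (apply `1 ⊗ λ` for a `ℚ`-linear retraction `λ` of `ℚ → M`). [cite: Deligne1971TravauxShimura, 4.9 p. 148] -/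
theorem exists_eq_algebraMap_of_one_tmul_eq (hR : Function.Injective (algebraMap ℚ R)) (y : M) (r : R)
    (h : (1 : R) ⊗ₜ[ℚ] y = r ⊗ₜ[ℚ] (1 : M)) : ∃ q : ℚ, y = algebraMap ℚ M q ∧ r = algebraMap ℚ R q := by
  obtain ⟨lam, hlam⟩ := (Algebra.linearMap ℚ M).exists_leftInverse_of_injective
    (LinearMap.ker_eq_bot.2 (algebraMap ℚ M).injective)
  have hlam1 : lam 1 = 1 := by
    have h1 := LinearMap.congr_fun hlam 1
    rw [LinearMap.comp_apply, Algebra.linearMap_apply, map_one, LinearMap.id_apply] at h1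
    exact h1
  have key := congrArg (fun z => TensorProduct.rid ℚ R (LinearMap.lTensor R lam z)) h
  simp only [LinearMap.lTensor_tmul, TensorProduct.rid_tmul, hlam1, one_smul] at key
  -- `key : lam y • 1 = r`
  refine ⟨lam y, ?_, by rw [← key, Algebra.algebraMap_eq_smul_one]⟩
  apply Algebra.TensorProduct.includeRight_injective (A := R) hR
  rw [Algebra.TensorProduct.includeRight_apply, Algebra.TensorProduct.includeRight_apply, h, ← key,
    Algebra.algebraMap_eq_smul_one, TensorProduct.smul_tmul]

variable {L : Type} [Field L] [NumberField L] (j : L →+* M)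

/-- `(1 ⊗ j)` (Mathlib's heterobasic `Algebra.TensorProduct.map (AlgHom.id R R) j`) is `lTensor j` pointwise. [folklore] -/
private theorem tensorMap_id_eq_lTensor (z : R ⊗[ℚ] L) :
    Algebra.TensorProduct.map (AlgHom.id R R) j.toRatAlgHom z = LinearMap.lTensor R j.toRatAlgHom.toLinearMap z := by
  induction z using TensorProduct.induction_on with
  | zero => rw [map_zero, map_zero]
  | tmul r l => rw [Algebra.TensorProduct.map_tmul, LinearMap.lTensor_tmul]; rfl
  | add a b ha hb => rw [map_add, map_add, ha, hb]

/-- **Descent along `j`**: if `(1 ⊗ j)(z) = 1 ⊗ x` in `R ⊗_ℚ M` for `z ∈ R ⊗_ℚ L`, then `z = 1 ⊗ l` (apply `1 ⊗ ρ`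
for a `ℚ`-linear retraction `ρ` of `j`, `ρ ∘ j = id`). [cite: Deligne1971TravauxShimura, 4.9 p. 148] -/
theorem exists_eq_one_tmul_of_map_eq_one_tmul (z : R ⊗[ℚ] L) (x : M)
    (h : Algebra.TensorProduct.map (AlgHom.id R R) j.toRatAlgHom z = (1 : R) ⊗ₜ[ℚ] x) :
    ∃ l : L, z = (1 : R) ⊗ₜ[ℚ] l := by
  obtain ⟨ρ, hρ⟩ := j.toRatAlgHom.toLinearMap.exists_leftInverse_of_injective (LinearMap.ker_eq_bot.2 j.injective)
  refine ⟨ρ x, ?_⟩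
  rw [tensorMap_id_eq_lTensor] at h
  have key := congrArg (LinearMap.lTensor R ρ) h
  rw [LinearMap.lTensor_tmul] at key
  rw [← key, ← LinearMap.comp_apply, ← LinearMap.lTensor_comp, hρ, LinearMap.lTensor_id, LinearMap.id_apply]

end Descent

/-! ### §3. Rational descent: `ũ_β(G₁(𝔸_f)) ∩ GSp_δ(ℚ) = ũ_β(G₁(ℚ))` -/

section RationalPoints

/-- There is a finite prime of a number field (`𝓞 K` is not a field). [folklore] -/
private theorem nonempty_heightOneSpectrum (K : Type) [Field K] [NumberField K] : Nonempty (HeightOneSpectrum (𝓞 K)) := by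
  obtain ⟨P, hP⟩ := Ideal.exists_maximal (𝓞 K)
  exact ⟨⟨P, hP.isPrime, Ring.ne_bot_of_isMaximal_of_not_isField hP (RingOfIntegers.not_isField K)⟩⟩

/-- `K → 𝔸_{K,f}` is injective (read at one finite place). [folklore] -/
private theorem algebraMap_finiteAdeleRing_injective (K : Type) [Field K] [NumberField K] :
    Function.Injective (algebraMap K (FiniteAdeleRing (𝓞 K) K)) := by
  obtain ⟨v⟩ := nonempty_heightOneSpectrum K
  intro x y hxy
  have h := congrArg (fun z : FiniteAdeleRing (𝓞 K) K => z v) hxy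
  simp only [FiniteAdeleRing.algebraMap_apply] at h
  exact (algebraMap K (v.adicCompletion K)).injective h

/-- `𝔸_{K,f}` is a nontrivial ring. [folklore] -/
private theorem nontrivial_finiteAdeleRing (K : Type) [Field K] [NumberField K] : Nontrivial (FiniteAdeleRing (𝓞 K) K) :=
  (algebraMap_finiteAdeleRing_injective K).nontrivial

variable {g : ℕ} (δ : Fin g → ℕ) in
/-- The diagonal `GSp_δ(ℚ) → GSp_δ(𝔸_{ℚ,f})` is injective. [cite: Milne2005ShimuraVarieties, §5 p. 56] -/
theorem gspRationalToFinAdelic_injective : Function.Injective (gspRationalToFinAdelic δ) := by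
  intro x y hxy
  refine Subtype.ext (Units.ext (Matrix.map_injective (algebraMap_finiteAdeleRing_injective ℚ) (congrArg
    (fun u : ↥(gspFinAdelic δ) => ((u : GL (Fin g ⊕ Fin g) finAdeleQ) : Matrix (Fin g ⊕ Fin g) (Fin g ⊕ Fin g) finAdeleQ)) hxy)))

variable {L : Type} [Field L] [NumberField L] [IsCMField L] {M : Type} [Field M] [NumberField M] [IsCMField M]
  {j : L →+* M} {H : Matrix (Fin 3) (Fin 3) L} {ξ₀ ξ : M} {g : ℕ} {δ : Fin g → ℕ}

/-- **Rational descent for `ũ_β`** (the hypothesis `u(G₁(𝔸_f)) ∩ G₂(ℚ) = u(G₁(ℚ))` of Deligne's injectivity criterion,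
for the auxiliary embedding of Prop. 2.3.10): if the finite-adelic image `ũ_β(a, t)` of `(a, t) ∈ U(H)(𝔸_f) × T₀(M)(𝔸_f)`
is (the diagonal image of) a rational similitude `γ ∈ GSp_δ(ℚ)`, then `a = (γ₀)_{𝔸_f}` and `t = (s)_{𝔸_f}` for a rational
pair `(γ₀, s) ∈ U(H)(ℚ) × T₀(M)(ℚ)` with `ũ_β(γ₀, s) = γ`.  Proof: `Q γ P` is a rational matrix equal to the restriction of
scalars of `diag(t̂, t̂·â)` over `𝔸_{ℚ,f} ⊗ M`, so `t̂ = 1 ⊗ t₀`, `â = 1 ⊗ A₀` (§2); the torus condition descends by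
`1 ⊗ y = q ⊗ 1 ⇒ y ∈ ℚ`, the entries of `a` descend along `1 ⊗ j` by a retraction of `j`, unitarity along the injective
`L → 𝔸_{L,f}`; finally `ũ_β(γ₀, s) = γ` by the square ★ `gspRationalToFinAdelic_auxToGspRat` and injectivity of the diagonal.
[cite: Deligne1971TravauxShimura, Prop. 1.15 p. 132, 1.15.3] [cite: Deligne1979ShimuraVarieties, Prop. 2.3.10 (PDF p. 32)] -/
theorem exists_auxToGspRat_eq_of_gspRationalToFinAdelic_eq (F : SymplecticFrame M j H ξ₀ ξ g δ) {γ : ↥(gspRational δ)}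
    {a : ↥(finAdelic (↥(maximalRealSubfield L)) L (IsCMField.complexConj L) 3 H)} {t : ↥(torusFinAdelic M)}
    (h : gspRationalToFinAdelic δ γ = auxToGspFin F (a, t)) :
    ∃ (γ₀ : ↥(rational (↥(maximalRealSubfield L)) L (IsCMField.complexConj L) 3 H)) (s : ↥(torusRat M)),
      rationalToFinAdelic (↥(maximalRealSubfield L)) L (IsCMField.complexConj L) 3 H γ₀ = a ∧
        toTorusFinAdelic M s = t ∧ auxToGspRat F (γ₀, s) = γ := by
  haveI := nontrivial_finiteAdeleRing M; haveI := nontrivial_finiteAdeleRing L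
  -- (S1) the equation in `GL_{2g}(𝔸_{ℚ,f})`, then in matrices
  have hGL : Matrix.GeneralLinearGroup.map (algebraMap ℚ finAdeleQ) (γ : GL (Fin g ⊕ Fin g) ℚ) =
      auxRep finAdeleQ F (torusToTensorFin M t, unitaryToTensorFin M j H a) := by
    have h' := congrArg Subtype.val h
    rwa [coe_gspRationalToFinAdelic, coe_auxToGspFin] at h'
  have hmat : (((γ : GL (Fin g ⊕ Fin g) ℚ) : Matrix (Fin g ⊕ Fin g) (Fin g ⊕ Fin g) ℚ).map (algebraMap ℚ finAdeleQ)) =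
      framePR finAdeleQ F *
        resMatrix (Algebra.TensorProduct.basis finAdeleQ (ratBasis M))
          ((blockGL (finAdeleQ ⊗[ℚ] M) (torusToTensorFin M t, unitaryToTensorFin M j H a) :
              GL (Fin 1 ⊕ Fin 3) (finAdeleQ ⊗[ℚ] M)) : Matrix (Fin 1 ⊕ Fin 3) (Fin 1 ⊕ Fin 3) (finAdeleQ ⊗[ℚ] M)) *
        frameQR finAdeleQ F := by
    have h' := congrArg (fun u : GL (Fin g ⊕ Fin g) finAdeleQ => (u : Matrix (Fin g ⊕ Fin g) (Fin g ⊕ Fin g) finAdeleQ)) hGL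
    rw [auxRep, MonoidHom.comp_apply, MonoidHom.comp_apply, coe_conjRect, coe_resGL] at h'
    exact h'
  -- (S2) `Q γ P` is rational and equals the restriction of scalars of `diag(t̂, t̂ â)`
  have hres : resMatrix (Algebra.TensorProduct.basis finAdeleQ (ratBasis M))
        ((blockGL (finAdeleQ ⊗[ℚ] M) (torusToTensorFin M t, unitaryToTensorFin M j H a) :
            GL (Fin 1 ⊕ Fin 3) (finAdeleQ ⊗[ℚ] M)) : Matrix (Fin 1 ⊕ Fin 3) (Fin 1 ⊕ Fin 3) (finAdeleQ ⊗[ℚ] M)) =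
      (frameQ F * ((γ : GL (Fin g ⊕ Fin g) ℚ) : Matrix (Fin g ⊕ Fin g) (Fin g ⊕ Fin g) ℚ) * frameP F).map
        (algebraMap ℚ finAdeleQ) := by
    rw [Matrix.map_mul, Matrix.map_mul, hmat]
    change _ = frameQR finAdeleQ F * (framePR finAdeleQ F * _ * frameQR finAdeleQ F) * framePR finAdeleQ F
    rw [show ∀ X : Matrix ((Fin 1 ⊕ Fin 3) × Fin (Module.finrank ℚ M)) ((Fin 1 ⊕ Fin 3) × Fin (Module.finrank ℚ M)) finAdeleQ,
        frameQR finAdeleQ F * (framePR finAdeleQ F * X * frameQR finAdeleQ F) * framePR finAdeleQ F =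
          (frameQR finAdeleQ F * framePR finAdeleQ F) * X * (frameQR finAdeleQ F * framePR finAdeleQ F) from
        fun X => by simp only [Matrix.mul_assoc], frameQR_mul_framePR, Matrix.one_mul, Matrix.mul_one]
  -- (S3) matrix descent: `diag(t̂, t̂ â) = 1 ⊗ A₀`
  obtain ⟨A₀, hA₀⟩ := exists_eq_map_one_tmul_of_resMatrix_eq_map _ _ hres
  set t₀ : M := A₀ (Sum.inl 0) (Sum.inl 0) with ht₀def
  have hcoeT : ((torusToTensorFin M t : (finAdeleQ ⊗[ℚ] M)ˣ) : finAdeleQ ⊗[ℚ] M) =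
      (ratFiniteAdeleTensorEquiv M).symm ((t : (FiniteAdeleRing (𝓞 M) M)ˣ) : FiniteAdeleRing (𝓞 M) M) := rfl
  have ht' : ((torusToTensorFin M t : (finAdeleQ ⊗[ℚ] M)ˣ) : finAdeleQ ⊗[ℚ] M) = (1 : finAdeleQ) ⊗ₜ[ℚ] t₀ := by
    have h11 := congrFun (congrFun hA₀ (Sum.inl 0)) (Sum.inl 0)
    rw [coe_blockGL, Matrix.fromBlocks_apply₁₁, Matrix.smul_apply, Matrix.one_apply_eq, smul_eq_mul, mul_one,
      Matrix.map_apply] at h11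
    exact h11
  have hX' : ∀ i k, ((torusToTensorFin M t : (finAdeleQ ⊗[ℚ] M)ˣ) : finAdeleQ ⊗[ℚ] M) *
      ((unitaryToTensorFin M j H a : GL (Fin 3) (finAdeleQ ⊗[ℚ] M)) : Matrix (Fin 3) (Fin 3) (finAdeleQ ⊗[ℚ] M)) i k =
        (1 : finAdeleQ) ⊗ₜ[ℚ] A₀ (Sum.inr i) (Sum.inr k) := fun i k => by
    have h22 := congrFun (congrFun hA₀ (Sum.inr i)) (Sum.inr k)
    rw [coe_blockGL, Matrix.fromBlocks_apply₂₂, Matrix.smul_apply, smul_eq_mul, Matrix.map_apply] at h22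
    exact h22
  -- (S4) the torus factor: `t = (t₀)_{𝔸_{M,f}}`, `t₀ c(t₀) ∈ ℚ^×`
  have htM : ((t : (FiniteAdeleRing (𝓞 M) M)ˣ) : FiniteAdeleRing (𝓞 M) M) = algebraMap M (FiniteAdeleRing (𝓞 M) M) t₀ := by
    apply (ratFiniteAdeleTensorEquiv M).symm.injective
    rw [ratFiniteAdeleTensorEquiv_symm_algebraMap, ← hcoeT, ht']
  have ht0 : t₀ ≠ 0 := fun h0 => (t : (FiniteAdeleRing (𝓞 M) M)ˣ).ne_zero (by rw [htM, h0, map_zero])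
  obtain ⟨q, hq⟩ := (mem_torusFinAdelic_iff M (t : (FiniteAdeleRing (𝓞 M) M)ˣ)).1 t.2
  have hy : algebraMap M (FiniteAdeleRing (𝓞 M) M) (t₀ * IsCMField.complexConj M t₀) =
      FiniteAdeleRing.baseChange (𝓞 ℚ) ℚ M (𝓞 M) (q : finAdeleQ) := by
    rw [← hq, htM, ← algebraMap_galConj_finiteAdele (↥(maximalRealSubfield M)) M (IsCMField.complexConj M) t₀, ← map_mul]
    rfl
  have h1y : (1 : finAdeleQ) ⊗ₜ[ℚ] (t₀ * IsCMField.complexConj M t₀) = (q : finAdeleQ) ⊗ₜ[ℚ] (1 : M) := by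
    apply (ratFiniteAdeleTensorEquiv M).injective
    rw [ratFiniteAdeleTensorEquiv_one_tmul, ratFiniteAdeleTensorEquiv_tmul, map_one, one_mul,
      finiteAdeleRing_mapSemialgHom_apply_eq_baseChange, hy]
  obtain ⟨q₀, hq₀, -⟩ := exists_eq_algebraMap_of_one_tmul_eq (algebraMap_finiteAdeleRing_injective ℚ) _ _ h1y
  have hq0 : q₀ ≠ 0 := by
    intro h0
    rw [h0, map_zero, mul_eq_zero] at hq₀
    rcases hq₀ with h0' | h0'
    · exact ht0 h0'
    · exact ht0 ((map_eq_zero_iff _ (IsCMField.complexConj M).injective).1 h0')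
  let s : ↥(torusRat M) := ⟨Units.mk0 t₀ ht0, (mem_torusRat_iff M _).2 ⟨Units.mk0 q₀ hq0, by
    rw [Units.val_mk0, Units.val_mk0]; exact hq₀⟩⟩
  have hs : toTorusFinAdelic M s = t := by
    refine Subtype.ext (Units.ext ?_)
    rw [coe_toTorusFinAdelic, FiniteAdeleRing.unitEmbedding_apply, htM]; rfl
  -- (S5) the unitary factor: entries of `a` descend along `1 ⊗ j`, then along `L → 𝔸_{L,f}`
  have hfa : ∀ i k, Algebra.TensorProduct.map (AlgHom.id finAdeleQ finAdeleQ) j.toRatAlgHom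
      ((ratFiniteAdeleTensorEquiv L).symm
        ((((a : GL (Fin 3) (FiniteAdeleRing (𝓞 L) L)) : Matrix (Fin 3) (Fin 3) (FiniteAdeleRing (𝓞 L) L)) i k))) =
        (1 : finAdeleQ) ⊗ₜ[ℚ] (t₀⁻¹ * A₀ (Sum.inr i) (Sum.inr k)) := fun i k => by
    change finAdeleToTensor M j _ = _
    change ((unitaryToTensorFin M j H a : GL (Fin 3) (finAdeleQ ⊗[ℚ] M)) : Matrix (Fin 3) (Fin 3) (finAdeleQ ⊗[ℚ] M)) i k = _
    apply (torusToTensorFin M t).isUnit.mul_left_cancel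
    rw [hX' i k, ht', Algebra.TensorProduct.tmul_mul_tmul, one_mul, mul_inv_cancel_left₀ ht0]
  choose l hl using fun i k => exists_eq_one_tmul_of_map_eq_one_tmul j _ _ (hfa i k)
  have hal : ∀ i k, (((a : GL (Fin 3) (FiniteAdeleRing (𝓞 L) L)) : Matrix (Fin 3) (Fin 3) (FiniteAdeleRing (𝓞 L) L)) i k) =
      algebraMap L (FiniteAdeleRing (𝓞 L) L) (l i k) := fun i k => by
    rw [← ratFiniteAdeleTensorEquiv_one_tmul, ← hl i k, RingEquiv.apply_symm_apply]
  have haΛ : (((a : GL (Fin 3) (FiniteAdeleRing (𝓞 L) L)) : Matrix (Fin 3) (Fin 3) (FiniteAdeleRing (𝓞 L) L))) =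
      (Matrix.of l).map (algebraMap L (FiniteAdeleRing (𝓞 L) L)) := by
    funext i k
    rw [Matrix.map_apply, Matrix.of_apply]
    exact hal i k
  have hdet : (Matrix.of l).det ≠ 0 := by
    intro h0
    have hu : IsUnit ((((a : GL (Fin 3) (FiniteAdeleRing (𝓞 L) L)) : Matrix (Fin 3) (Fin 3) (FiniteAdeleRing (𝓞 L) L))).det) :=
      ⟨Matrix.GeneralLinearGroup.det (a : GL (Fin 3) (FiniteAdeleRing (𝓞 L) L)), rfl⟩
    rw [haΛ, ← RingHom.mapMatrix_apply, ← RingHom.map_det, h0, map_zero] at hu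
    exact not_isUnit_zero hu
  let γ₁ : GL (Fin 3) L := Matrix.GeneralLinearGroup.mkOfDetNeZero (Matrix.of l) hdet
  have hγ₁ : ((γ₁ : GL (Fin 3) L) : Matrix (Fin 3) (Fin 3) L) = Matrix.of l := rfl
  have hmapγ : Matrix.GeneralLinearGroup.map (algebraMap L (FiniteAdeleRing (𝓞 L) L)) γ₁ =
      (a : GL (Fin 3) (FiniteAdeleRing (𝓞 L) L)) := by
    apply Units.ext
    change (((γ₁ : GL (Fin 3) L) : Matrix (Fin 3) (Fin 3) L)).map (algebraMap L (FiniteAdeleRing (𝓞 L) L)) = _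
    rw [hγ₁, haΛ]
  -- unitarity descends along the injective `L → 𝔸_{L,f}`
  have hmem : γ₁ ∈ rational (↥(maximalRealSubfield L)) L (IsCMField.complexConj L) 3 H := by
    rw [rational, mem_unitaryGroupOfForm_iff, hγ₁]
    have hu := (mem_finAdelic_iff (↥(maximalRealSubfield L)) L (IsCMField.complexConj L) 3 H
      (a : GL (Fin 3) (FiniteAdeleRing (𝓞 L) L))).1 a.2
    rw [haΛ] at hu
    apply Matrix.map_injective (algebraMap_finiteAdeleRing_injective L)
    have hconj : ((Matrix.of l).map (algebraMap L (FiniteAdeleRing (𝓞 L) L))).map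
        (conjFiniteAdele (↥(maximalRealSubfield L)) L (IsCMField.complexConj L)) =
          ((Matrix.of l).map ((IsCMField.complexConj L : L ≃ₐ[↥(maximalRealSubfield L)] L) : L →+* L)).map
            (algebraMap L (FiniteAdeleRing (𝓞 L) L)) := by
      funext i k
      simp only [Matrix.map_apply]
      rw [← algebraMap_galConj_finiteAdele (↥(maximalRealSubfield L)) L (IsCMField.complexConj L)]
    have hform : finiteAdelicForm L 3 H = H.map (algebraMap L (FiniteAdeleRing (𝓞 L) L)) := rfl
    rw [hconj, hform, ← Matrix.transpose_map, ← Matrix.map_mul, ← Matrix.map_mul] at hu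
    simpa only using hu
  -- (S6) assemble and compare through the injective diagonal `GSp_δ(ℚ) → GSp_δ(𝔸_{ℚ,f})`
  have hγ₀ : rationalToFinAdelic (↥(maximalRealSubfield L)) L (IsCMField.complexConj L) 3 H ⟨γ₁, hmem⟩ = a :=
    Subtype.ext (by rw [coe_rationalToFinAdelic]; exact hmapγ)
  refine ⟨⟨γ₁, hmem⟩, s, hγ₀, hs, gspRationalToFinAdelic_injective δ ?_⟩
  rw [gspRationalToFinAdelic_auxToGspRat, hs, hγ₀, h]

end RationalPoints

end Aux

end UnitaryCanonicalModel

end Literature.AlgebraicGeometry.ShimuraVarieties
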